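import Summits.QuantumFields.QCD.Theorems.SpectralDefectExtinctionWindowExtinctionStubFluxTemplateHalfSpectral
import Summits.QuantumFields.QCD.Theorems.SpectralDefectExtinctionWindowExtinctionKatoBudgetRadius
import Summits.QuantumFields.QCD.Theorems.SpectralDefectExtinctionWindowExtinctionKatoHermitianEigenForm
import Summits.QuantumFields.QCD.Theorems.SpectralDefectExtinctionWindowExtinctionSpreadR3Window
import HarnessLib

/-!
# The radius floor of an index-carrying template (crux `WindowExtinction`, line `free-volume-heavy-witness` r3,
# stub `stub_indexTemplate`)

Helper file of the lead (seat c2) for the ONE open stub `stub_indexTemplate` of the registered r3 skeleton of crux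
`Summit.QuantumFields.QCD.Theses.SpectralDefectExtinction.WindowExtinction` (item stmt-QuantumFields-8964).  After
the landings of `stub_fluxTemplateHalf` (p118924) and `stub_spreadFromPartsR3` (p120377) the crux AS TYPED is
kernel-reduced to `IndexTemplate`: for every window `0 < lo ≤ hi ≤ Q·lo`, `hi ≤ 1/4`, a radius `R` and a
Haar-positive template class whose box principal block of `Γ₅ (D_W(U) − δ)` has index excess
`negRootCount − 6(2R+1)⁴ ≥ 96(2R+1)³ + 1` at EVERY probe `δ ∈ [lo, hi]`, in every environment.

This file proves the deterministic NECESSITY that governs any such template (tree vocabulary only):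

* `indexTemplate_radius_floor` (registered): there is an absolute `c₀ > 0` (the constant of the landed Kato lever
  `stub_katoBudgetRadius`, `c₀ = 1/1024`) such that on every torus of side `n ≥ 8(R+1)`, for EVERY `SU(3)` field
  `U`, every centre `c` and every probe `δ < c₀/(R+1)²`, the box principal block of `Γ₅ D_W(U, −δ, 1)` over the
  image of `c + {−R,…,R}⁴` is invertible and has EXACTLY `6(2R+1)⁴` negative eigenvalues — no index excess at all.
  Proof: a spinor supported on the box image is `(1/10)`-localised in `torusBox n c R` (all of its mass is there),
  so the Kato lever gives `Re⟨ψ, D_W(U,0,1)ψ⟩ ≥ c₀/(R+1)² ‖ψ‖²`; hence the Wilson form at mass `−δ` is coercive with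
  `κ = c₀/(R+1)² − δ > 0`, and the landed chiral min–max `stub_fluxTemplateHalf_spectral` concludes.
* `indexTemplate_radius_ge` (registered): consequently ANY datum `(R, Tp)` satisfying the conclusion of
  `IndexTemplate` at a window `[lo, hi]` with `Tp` non-empty has `c₀/(R+1)² ≤ lo` — index-carrying templates have
  radius `R + 1 ≥ (c₀/lo)^{1/2}`; along the scheme sequence of the reduction (`lo_k = a_k/((K+1)Z_k) → 0`) the
  templates must grow without bound, so no finite family of certified configurations can discharge the stub.

Nothing here is specific to the free-volume line: the floor is a statement about every gauge field.
-/

noncomputable section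

namespace Summit.QuantumFields.QCD.Cruxes.WindowExtinction.FreeVolumeHeavyWitness

open Matrix MeasureTheory
open Literature.MathematicalPhysics Literature.MathematicalPhysics.QuantumLattice
  Literature.MathematicalPhysics.QuantumFieldTheory Literature.Probability.LatticeModels
open Summit.QuantumFields.QCD.Theorems.ExtinctionBuildsQCD.Negative
open scoped BigOperators ComplexConjugate

/-- A spinor supported on the image of the box `c + {−R,…,R}⁴` carries ALL of its mass in `torusBox n c R`,
hence is `ε`-localised there for every `ε ≥ 0`. -/
theorem radiusFloor_isBoxLocalised_of_support {n : ℕ} [NeZero n] (R : ℕ) (c : Fin 4 → ℤ)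
    (ψ : TorusSite 4 n × Fin 3 × Fin 4 → ℂ)
    (hψ : ∀ p : TorusSite 4 n × Fin 3 × Fin 4,
      (¬ ∃ y : ↥(box 4 R), Torus.proj n (c + (y : Fin 4 → ℤ)) = p.1) → ψ p = 0)
    {ε : ℝ} (hε : 0 ≤ ε) :
    IsBoxLocalised ψ (torusBox n c R) ε := by
  have hmass : boxMass ψ (torusBox n c R) = ∑ i, ‖ψ i‖ ^ 2 := by
    unfold boxMass
    rw [Finset.sum_filter]
    refine Finset.sum_congr rfl fun i _ => ?_
    by_cases hi : i.1 ∈ torusBox n c R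
    · rw [if_pos hi]
    · rw [if_neg hi]
      have hzero : ψ i = 0 := by
        refine hψ i fun ⟨y, hy⟩ => hi ?_
        exact Finset.mem_image.mpr ⟨(y : Fin 4 → ℤ), y.2, hy⟩
      rw [hzero, norm_zero]
      ring
  unfold IsBoxLocalised
  rw [hmass]
  have hS : 0 ≤ ∑ i, ‖ψ i‖ ^ 2 := Finset.sum_nonneg fun _ _ => by positivity
  nlinarith

/-- **Registered helper `indexTemplate_radius_floor` (the radius floor, every gauge field).**  There is an absolute
`c₀ > 0` such that for `8(R+1) ≤ n`, every field `U`, every centre `c` and every probe `δ < c₀/(R+1)²`, the box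
principal block of `Γ₅ D_W(U, −δ, 1)` over the image of `c + {−R,…,R}⁴` is invertible with exactly `6(2R+1)⁴`
negative eigenvalues (zero index excess). -/
theorem indexTemplate_radius_floor :
    ∃ c₀ : ℝ, 0 < c₀ ∧ ∀ (n : ℕ) [NeZero n] (R : ℕ) (c : Fin 4 → ℤ), 8 * (R + 1) ≤ n →
      ∀ (U : GaugeConfig 4 n SU3) (δ : ℝ), δ < c₀ / ((R : ℝ) + 1) ^ 2 →
        ((spinorLift gammaFive * wilsonDirac (fundamentalRep (Fin 3)) U (-δ) 1).submatrix
            (Subtype.val : {p : TorusSite 4 n × Fin 3 × Fin 4 //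
              ∃ y : ↥(box 4 R), Torus.proj n (c + (y : Fin 4 → ℤ)) = p.1} → _) Subtype.val).det ≠ 0 ∧
        negRootCount ((spinorLift gammaFive * wilsonDirac (fundamentalRep (Fin 3)) U (-δ) 1).submatrix
            (Subtype.val : {p : TorusSite 4 n × Fin 3 × Fin 4 //
              ∃ y : ↥(box 4 R), Torus.proj n (c + (y : Fin 4 → ℤ)) = p.1} → _) Subtype.val) =
          6 * (2 * R + 1) ^ 4 := by
  obtain ⟨c₀, hc₀, hKato⟩ := KatoRadiusCollectiveDefects.stub_katoBudgetRadius
  refine ⟨c₀, hc₀, fun n _ R c hn U δ hδ => ?_⟩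
  have hn' : 2 * R + 1 < n := by omega
  have hκ : 0 < c₀ / ((R : ℝ) + 1) ^ 2 - δ := sub_pos.mpr hδ
  refine stub_fluxTemplateHalf_spectral n R c hn' U (-δ) (c₀ / ((R : ℝ) + 1) ^ 2 - δ) hκ fun ψ hψ => ?_
  -- the Wilson form at mass `-δ` splits as the massless form minus `δ‖ψ‖²`
  have hsplit : (star ψ ⬝ᵥ (wilsonDirac (fundamentalRep (Fin 3)) U (-δ) 1 *ᵥ ψ)).re =
      (star ψ ⬝ᵥ (wilsonDirac (fundamentalRep (Fin 3)) U 0 1 *ᵥ ψ)).re - δ * ∑ i, ‖ψ i‖ ^ 2 := by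
    rw [wilsonDirac_mass_eq_add_scalar (fundamentalRep (Fin 3)) U (-δ) 1, Matrix.add_mulVec,
      KatoRadiusCollectiveDefects.scalar_mulVec_eq_smul, dotProduct_add, Complex.add_re,
      KatoRadiusCollectiveDefects.re_star_dotProduct_smul]
    ring
  by_cases hψ0 : ψ = 0
  · subst hψ0
    simp
  · -- Kato lever on the box-supported (hence fully localised) spinor
    have hloc : IsBoxLocalised ψ (torusBox n c R) (1 / 10) :=
      radiusFloor_isBoxLocalised_of_support R c ψ hψ (by norm_num)
    have hS : 0 < ∑ i, ‖ψ i‖ ^ 2 := sum_norm_sq_pos hψ0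
    set t : ℝ := (star ψ ⬝ᵥ (wilsonDirac (fundamentalRep (Fin 3)) U 0 1 *ᵥ ψ)).re / ∑ i, ‖ψ i‖ ^ 2 with ht
    have hle : (star ψ ⬝ᵥ (wilsonDirac (fundamentalRep (Fin 3)) U 0 1 *ᵥ ψ)).re ≤ t * ∑ i, ‖ψ i‖ ^ 2 := by
      rw [ht, div_mul_cancel₀ _ hS.ne']
    have hlev := hKato n U ψ t c R hψ0 hn hle hloc
    -- `c₀/(R+1)² ≤ t`, i.e. the massless form is at least `c₀/(R+1)² ‖ψ‖²`
    have hform : c₀ / ((R : ℝ) + 1) ^ 2 * ∑ i, ‖ψ i‖ ^ 2 ≤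
        (star ψ ⬝ᵥ (wilsonDirac (fundamentalRep (Fin 3)) U 0 1 *ᵥ ψ)).re := by
      have := mul_le_mul_of_nonneg_right hlev hS.le
      rwa [ht, div_mul_cancel₀ _ hS.ne'] at this
    rw [hsplit]
    nlinarith

/-- **Registered helper `indexTemplate_radius_ge` (IndexTemplate data obey the radius floor).**  With the constant
`c₀` of `indexTemplate_radius_floor`: if a radius `R` and a NON-EMPTY template class `Tp` satisfy the conclusion
of `IndexTemplate` at the window `[lo, hi]` (invertible box block with index excess `≥ 96(2R+1)³ + 1` at every probe
of the window, on every torus `n > 2R+1`, every centre, every field whose box content lies in `Tp`), then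
`c₀/(R+1)² ≤ lo`.  Proof: implant a template of `Tp` on the torus of side `8(R+1)` (`spreadR3_exists_config_with_content`);
at the probe `δ = lo < c₀/(R+1)²` the floor gives excess `0 < 96(2R+1)³ + 1`. -/
theorem indexTemplate_radius_ge :
    ∃ c₀ : ℝ, 0 < c₀ ∧ ∀ (lo hi : ℝ), lo ≤ hi → ∀ (R : ℕ) (Tp : Set ((↥(box 4 R) × Fin 4) → SU3)), Tp.Nonempty →
      (∀ δ : ℝ, lo ≤ δ → δ ≤ hi → ∀ (n : ℕ) [NeZero n], 2 * R + 1 < n →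
        ∀ (c : Fin 4 → ℤ) (U : GaugeConfig 4 n SU3),
          (fun yi : ↥(box 4 R) × Fin 4 => U (Torus.proj n (c + (yi.1 : Fin 4 → ℤ)), yi.2)) ∈ Tp →
          ((spinorLift gammaFive * wilsonDirac (fundamentalRep (Fin 3)) U (-δ) 1).submatrix
              (Subtype.val : {p : TorusSite 4 n × Fin 3 × Fin 4 //
                ∃ y : ↥(box 4 R), Torus.proj n (c + (y : Fin 4 → ℤ)) = p.1} → _) Subtype.val).det ≠ 0 ∧
          6 * (2 * R + 1) ^ 4 + 96 * (2 * R + 1) ^ 3 + 1 ≤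
            negRootCount ((spinorLift gammaFive * wilsonDirac (fundamentalRep (Fin 3)) U (-δ) 1).submatrix
              (Subtype.val : {p : TorusSite 4 n × Fin 3 × Fin 4 //
                ∃ y : ↥(box 4 R), Torus.proj n (c + (y : Fin 4 → ℤ)) = p.1} → _) Subtype.val)) →
      c₀ / ((R : ℝ) + 1) ^ 2 ≤ lo := by
  obtain ⟨c₀, hc₀, hfloor⟩ := indexTemplate_radius_floor
  refine ⟨c₀, hc₀, fun lo hi hlohi R Tp hTp hIT => ?_⟩
  by_contra hlt
  push Not at hlt
  obtain ⟨t, ht⟩ := hTp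
  -- the torus of side `8(R+1)` carries a field with box content `t` about the centre `0`
  haveI : NeZero (8 * (R + 1)) := ⟨by omega⟩
  have h8 : 2 * R + 1 ≤ 8 * (R + 1) := by omega
  obtain ⟨U, hU⟩ := spreadR3_exists_config_with_content (n := 8 * (R + 1)) h8 0 t
  have hmem : (fun yi : ↥(box 4 R) × Fin 4 =>
      U (Torus.proj (8 * (R + 1)) (0 + (yi.1 : Fin 4 → ℤ)), yi.2)) ∈ Tp := by
    rw [hU]; exact ht
  have hlt' : 2 * R + 1 < 8 * (R + 1) := by omega
  obtain ⟨-, hge⟩ := hIT lo le_rfl hlohi (8 * (R + 1)) hlt' 0 U hmem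
  obtain ⟨-, heq⟩ := hfloor (8 * (R + 1)) R 0 le_rfl U lo hlt
  rw [heq] at hge
  have : 0 < 96 * (2 * R + 1) ^ 3 + 1 := by positivity
  omega

end Summit.QuantumFields.QCD.Cruxes.WindowExtinction.FreeVolumeHeavyWitness

end
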